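import Summits.AtomisticToContinuum.Crystallization.Theorems.ChartedZeroExcessLayeredLatticeLiouvilleYIB

/-!
# Charted zero-excess layered-lattice Liouville — YI «ColdMoatDial + MildDoorVariationalSplit» — part 3 of 3 (sequel of `…ChartedZeroExcessLayeredLatticeLiouvilleYIB`)

Split for the 400-line cap by the landing lane (hand-2 g32); the module docstring of part 1 (`…ChartedZeroExcessLayeredLatticeLiouvilleYIA`) describes the whole node.  Same namespace; all FQNs unchanged.
0 sorry; standard axioms.
-/

noncomputable section
open scoped BigOperators Classical
open MeasureTheory Set Metric Filter Topology
open Summit.AtomisticToContinuum.Crystallization.Theorems.ChartedPlanarOrderRigidityDoor (E3 eStar atomsIn IsEStarGSC siteEnergy VisibleGap PertRegime)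
open Summit.AtomisticToContinuum.Crystallization.Theorems.ChartedPlanarOrderDensityDichotomy (μS IsSep nK nK_nonneg)
open Summit.AtomisticToContinuum.Crystallization.Theorems.ChartedPlanarOrderCleanScaleP (IsCleanP IsDoorSetP)
open Summit.AtomisticToContinuum.Crystallization.Theorems.ChartedPlanarOrderMesoCut (LayeredHom EnvClose)
open Summit.AtomisticToContinuum.Crystallization.Theorems.ChartedPlanarOrderDoorLayered (atomsIn_subset sq_le_finsum_mem PeriodicBulkGapDoor)
open Summit.AtomisticToContinuum.Crystallization.Theorems.ChartedPlanarOrderDoorLayeredOsc (IsTwoShellAffineGood)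
open Literature.MathematicalPhysics.StatisticalMechanics (card_le_of_separated_of_dist_le lennardJones)

namespace Summit.AtomisticToContinuum.Crystallization.Theorems.ChartedZeroExcessLayeredLatticeLiouville

/-! ### YI-5  (M1′) «MildDoorVariationalSplit» (CRITIC-LEDGER row 1189 (c″)): the mild clamped door [MCMCᶜ] ⟸ (QE) a SLAVED TAME CRITICAL FILLING exists
(perturbative in the DATA — the moat-temperature dial) ∧ (QC) STRONG CONVEXITY of the clamped energy about critical tame fillings along matched segments in the
MILD class (the AMPLITUDE axis — a Born-type harmonic floor on all mild configurations); the variational glue PROVED; columns `_16XH28BV` / `_16XH28BVT` -/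

/-- ★★★ **(QE) «CoolMoatSlavedFillingP ϑc ϑ ϑp r q rsh ρ rm dm aHi Λ θ s» — EXISTENCE OF THE SLAVED TAME CRITICAL FILLING.**  For every θ-good `aHi`-door set `S`
(`IsDoorSetP`, summable pair sums — NO grand-canonical hypothesis), equilibrium `s`-chart `(L, w)` at scale `a`, centre `x₀`, container `K ⊆ S ∩ B̄(x₀, q)` with
`ϑp`-TAME `rm`-core (the MILD hypothesis of part YH) and `ϑc`-TAME moat `moatIn S K r (r + rsh)`, and every injective enumeration `xf : Fin n → E3` of the `ρ`-core
`coreOf S K ρ`: there is a filling `y : Fin n → E3` of the SAME count which is (i) injective and off the frozen exterior `S ∖ core`, (ii) MATCHED to `xf` within `dm`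
sitewise, (iii) a CLAMPED CRITICAL POINT — `HasFDerivAt (clampedEnergy (S ∖ core)) 0 y` on `Fin n → E3` —, and (iv) `ϑ`-TAME at every site relative to the glued
configuration `(S ∖ core) ∪ range y` and the chart.  THE EXISTENCE HALF OF THE IMPLICIT-FUNCTION DISCHARGE of the mild door: elastic relaxation of the `ρ`-core
under `ϑc`-cool thick-shell data about the chart (linearised operator `κ₀`-coercive by the column's (U♮ᴱ) `UniformTameStabilityE`, zero-extended to the clamped
ball; Newton–Kantorovich about the chart placement fitted to the moat; the solution's star misfit `≲ C_d·ϑc + C_t·(r⁻⁶ tail beyond the moat)` must be `≤ ϑ`).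
PERTURBATIVE IN THE DATA: TRUE-type for `ϑc ≤ ϑc⋆(κ₀, C_d)` — at the record `ϑc = 1/100` the budget `C_d/100 ≤ 1/20` needs `C_d ≤ 5` (marginal: elastic
Green's-function constants of a `20`-ball are `O(1–10)`), and THIS IS WHERE THE MOAT-TEMPERATURE DIAL OF YI-2/YI-4 BITES (`ϑm ≤ 1/(20·C_d)` costs nothing).
ANALYTIC · LOCAL · FINITE · UNDECIDED · ATTACKABLE·M–L (E–Ming / Ortner–Theil small-data theory on a finite clamped ball; the tilt-blindness of `IsTameStar`
absorbs the rotation drift of bent data, frame step (K1) of part YF) · INSTRUMENTABLE («CoolMoatGap» returns `y`: clamped relaxation from the chart filling under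
the sampled cool data, report its max star misfit and the matched distance to the sampled core).  SIDEWAYS w.r.t. [MCMCᶜ] (not implied by it).
Why it might fail: `C_d·ϑc > ϑ` at the record moat level (repair: the dial); a clamped critical filling that is tame but NOT matched within `dm` to the given mild
core because the local chart placements of core and data differ by a lattice VECTOR (registry slip across the collar — excluded when `rm ≥ ρ` makes the whole core
mild for ONE pattern map, to be checked in the proof); differentiability of the exterior pair sum at `y` (separation of `S`, `r⁻⁷` tails: routine).
Sources: part YH ([MCMCᶜ], (K3′)); part TP ((U♮ᴱ)); E–Ming, Arch. Ration. Mech. Anal. 183 (2007) 241; Ortner–Theil, Arch. Ration. Mech. Anal. 207 (2013) 1025;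
Ehrlacher–Ortner–Shapeev, Arch. Ration. Mech. Anal. 222 (2016) 1217 (clamped/far-field coupling, Thm 2.1-type regularity); CRITIC-LEDGER row 1189 (c″). [this file, g65] -/
def CoolMoatSlavedFillingP (ϑc ϑ ϑp r q rsh ρ rm dm aHi Λ θ s : ℝ) : Prop :=
  ∀ δ : ℝ, 0 < δ → ∀ a : ℝ, 0 < a →
    ∀ S : Set E3, IsDoorSetP aHi δ S → (∀ z : E3, Summable fun y : S => lennardJones (dist z (y : E3))) →
      (∀ p ∈ S, IsTwoShellAffineGood θ S p) →
        ∀ (L : E3 ≃L[ℝ] E3) (w : ℤ → E3), IsEquilChart a s Λ L w →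
          ∀ (x₀ : E3) (K : Set E3), K ⊆ S → (∀ k ∈ K, dist k x₀ ≤ q) →
            IsTameOn ϑp S (LayeredHom (L : E3 →L[ℝ] E3) w) (coreOf S K rm) →
              IsTameOn ϑc S (LayeredHom (L : E3 →L[ℝ] E3) w) (moatIn S K r (r + rsh)) →
                ∀ (n : ℕ) (xf : Fin n → E3), Function.Injective xf → Set.range xf = coreOf S K ρ →
                  ∃ y : Fin n → E3, Function.Injective y ∧ Disjoint (Set.range y) (S \ coreOf S K ρ) ∧ (∀ i, dist (xf i) (y i) ≤ dm) ∧
                    HasFDerivAt (fun z : Fin n → E3 => clampedEnergy (S \ coreOf S K ρ) z) (0 : (Fin n → E3) →L[ℝ] ℝ) y ∧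
                      ∀ i, IsTameStar ϑ ((S \ coreOf S K ρ) ∪ Set.range y) (LayeredHom (L : E3 →L[ℝ] E3) w) (y i)

/-- ★★★ **(QC) «MildClampedConvexityP ϑ ϑp q ρ rm dm κ aHi Λ θ s» — STRONG CONVEXITY OF THE CLAMPED ENERGY ABOUT TAME CRITICAL FILLINGS, ALONG MATCHED SEGMENTS IN THE
MILD CLASS.**  For every θ-good `aHi`-door set `S` with summable pair sums, equilibrium chart, centre, container `K ⊆ S ∩ B̄(x₀, q)` with `ϑp`-tame `rm`-core, every
injective enumeration `xf` of the `ρ`-core and every filling `y` of the same count that is matched to `xf` within `dm`, injective, off the exterior, CLAMPED-CRITICAL and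
`ϑ`-tame at every site: `clampedEnergy (S ∖ core) y + κ·Σᵢ dist(xf i, y i)² ≤ clampedEnergy (S ∖ core) xf`.  THE AMPLITUDE HALF of the discharge: the segment
`t ↦ (1 − t)·y + t·xf` interpolates MATCHED near-crystalline stars, so every intermediate configuration is `(max(ϑp, ϑ) + O(|ΔU|²))`-tame and separated; a uniform
HARMONIC FLOOR `D²(clampedEnergy) ≥ 2κ` on that mild⁺ class (a BORN-type stability of ALL `≈ 2.5 %`-strained clean Lennard-Jones configurations in the clamped
ball — not only of the chart) plus criticality of `y` integrate to the inequality.  LEVEL-FREE IN THE MOAT TEMPERATURE; the level that matters is the amplitude `ϑp`.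
ANALYTIC · LOCAL · FINITE · UNDECIDED · TRUE-type-expected at `ϑp = 1/10` (bond strains `≤ 2.5 %`; Lennard-Jones fcc/hcp are Born-stable to several per cent of
homogeneous strain, nearest-neighbour `V″` stays positive up to the inflection stretch `≈ 11 %`) · CERT-able (interval bound on star stiffness matrices over the
mild strain range) · INSTRUMENTABLE («MildBorn(ϑp)»: smallest eigenvalue of the clamped Hessian over sampled mild cores and along sampled matched segments).
SIDEWAYS w.r.t. [MCMCᶜ].  No implicit-function RADIUS literal is needed: convexity is asserted on the mild class itself, so CRITIC-LEDGER row 1189 (c″)'s «IFT radius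
≥ 1/10 by norm_num or re-instantiate lower» becomes «Born floor at amplitude `1/10`, else re-instantiate `ϑp` lower (part YG's amplitude dial, at the price of a
stronger [WHSᵇ](ϑp))».
Why it might fail: the programme's own stiffness-drift estimate (part TP: `V″` moves `≈ 20 %` per `1 %` bond strain against a `≈ 15 %` relative coercivity margin of
the chart) would, if the margin were eaten UNIFORMLY, put `2.5 %`-strained cores outside the harmonic basin — the bet is that the `15 %` margin is the soft
INTERLAYER-SHEAR mode, whose stiffness is not governed by nearest-neighbour `V″` drift, and that Born stability of the strained cell holds to `≳ 4 %`; a mild core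
with a genuinely unstable clamped phonon at `≤ 2.5 %` strain refutes (QC)(1/10) and forces `ϑp ↓` (residual [WHSᵇ](ϑp) ↑).
Sources: part TP ((U♮ᴱ), stiffness drift); part YH ([MCMC] why-it-might-fail); Wallace, Thermodynamics of Crystals (1972) §(Born stability); E–Ming 2007 §2;
Ortner–Theil 2013 (stability of Cauchy–Born states); CRITIC-LEDGER row 1189 (c″). [this file, g65] -/
def MildClampedConvexityP (ϑ ϑp q ρ rm dm κ aHi Λ θ s : ℝ) : Prop :=
  ∀ δ : ℝ, 0 < δ → ∀ a : ℝ, 0 < a →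
    ∀ S : Set E3, IsDoorSetP aHi δ S → (∀ z : E3, Summable fun y : S => lennardJones (dist z (y : E3))) →
      (∀ p ∈ S, IsTwoShellAffineGood θ S p) →
        ∀ (L : E3 ≃L[ℝ] E3) (w : ℤ → E3), IsEquilChart a s Λ L w →
          ∀ (x₀ : E3) (K : Set E3), K ⊆ S → (∀ k ∈ K, dist k x₀ ≤ q) →
            IsTameOn ϑp S (LayeredHom (L : E3 →L[ℝ] E3) w) (coreOf S K rm) →
              ∀ (n : ℕ) (xf : Fin n → E3), Function.Injective xf → Set.range xf = coreOf S K ρ →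
                ∀ y : Fin n → E3, (∀ i, dist (xf i) (y i) ≤ dm) → Function.Injective y → Disjoint (Set.range y) (S \ coreOf S K ρ) →
                  HasFDerivAt (fun z : Fin n → E3 => clampedEnergy (S \ coreOf S K ρ) z) (0 : (Fin n → E3) →L[ℝ] ℝ) y →
                    (∀ i, IsTameStar ϑ ((S \ coreOf S K ρ) ∪ Set.range y) (LayeredHom (L : E3 →L[ℝ] E3) w) (y i)) →
                      clampedEnergy (S \ coreOf S K ρ) y + κ * ∑ i, dist (xf i) (y i) ^ 2 ≤ clampedEnergy (S \ coreOf S K ρ) xf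

/-- **(QE) WEAKENS as the moat cools (PROVED)** — `ϑm ≤ ϑc`: a cooler moat is a stronger hypothesis; the dial applies to the existence half. [this file, g65] -/
theorem CoolMoatSlavedFillingP.of_moat_le {ϑm ϑc ϑ ϑp r q rsh ρ rm dm aHi Λ θ s : ℝ} (h : ϑm ≤ ϑc)
    (hE : CoolMoatSlavedFillingP ϑc ϑ ϑp r q rsh ρ rm dm aHi Λ θ s) : CoolMoatSlavedFillingP ϑm ϑ ϑp r q rsh ρ rm dm aHi Λ θ s :=
  fun δ hδ a ha S hS hsum hgood L w hLw x₀ K hKS hKq hmild hcool n xf hxf hrange =>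
    hE δ hδ a ha S hS hsum hgood L w hLw x₀ K hKS hKq hmild (IsTameOn.mono h Subset.rfl hcool) n xf hxf hrange

/-- **(QC) WEAKENS as `κ` decreases (PROVED)** — a smaller convexity modulus is a weaker claim (`0 ≤` the matched sum of squares). [this file, g65] -/
theorem MildClampedConvexityP.of_le {ϑ ϑp q ρ rm dm κ κ' aHi Λ θ s : ℝ} (h : κ' ≤ κ) (hC : MildClampedConvexityP ϑ ϑp q ρ rm dm κ aHi Λ θ s) :
    MildClampedConvexityP ϑ ϑp q ρ rm dm κ' aHi Λ θ s := by
  intro δ hδ a ha S hS hsum hgood L w hLw x₀ K hKS hKq hmild n xf hxf hrange y hnear hyinj hydisj hcrit htame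
  have key := hC δ hδ a ha S hS hsum hgood L w hLw x₀ K hKS hKq hmild n xf hxf hrange y hnear hyinj hydisj hcrit htame
  have hs : 0 ≤ ∑ i, dist (xf i) (y i) ^ 2 := Finset.sum_nonneg fun i _ => by positivity
  nlinarith

/-- ★★★ **THE VARIATIONAL GLUE (PROVED): (QE)(dm) ∧ (QC)(dm, κ > 0) ⇒ [MCMCᶜ]** (`0 ≤ ρ`).  Enumerate the finite `ρ`-core as `xf`; (QE) gives the slaved tame critical
filling `y` matched to `xf`; (QC) gives `E(y) + κ·Σ dist² ≤ E(xf)`; grand clamped minimality of the core with the equal-count replacement `R := y` gives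
`E(xf) ≤ E(y)`; hence `Σ dist² ≤ 0`, `y = xf`, the glued configuration `(S ∖ core) ∪ range y` is `S` itself, and every site of `K ⊆ core` carries a `ϑ`-tame star. -/
theorem mildCoolMoatClampedCoreP_of_slavedFilling_convexity {ϑc ϑ ϑp r q rsh ρ rm dm κ aHi Λ θ s : ℝ} (hκ : 0 < κ) (hρ : 0 ≤ ρ)
    (hE : CoolMoatSlavedFillingP ϑc ϑ ϑp r q rsh ρ rm dm aHi Λ θ s) (hC : MildClampedConvexityP ϑ ϑp q ρ rm dm κ aHi Λ θ s) :
    MildCoolMoatClampedCoreP ϑc ϑ ϑp r q rsh ρ rm aHi Λ θ s := by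
  intro δ hδ a ha S hS hsum hgood L w hLw x₀ K hKS hKq hmild hcool hmin
  have hKf : K.Finite :=
    (Literature.Probability.Process.LocalConfig.finite_inter_of_separated hδ hS.2.1 (isCompact_closedBall x₀ q)).subset
      fun k hk => ⟨mem_closedBall.2 (hKq k hk), hKS hk⟩
  obtain ⟨n, f, hf⟩ := (coreOf_finite hδ hS.2.1 hKf ρ).fin_embedding
  obtain ⟨y, hyinj, hydisj, hnear, hcrit, htame⟩ := hE δ hδ a ha S hS hsum hgood L w hLw x₀ K hKS hKq hmild hcool n f f.injective hf
  have hineq := hC δ hδ a ha S hS hsum hgood L w hLw x₀ K hKS hKq hmild n f f.injective hf y hnear hyinj hydisj hcrit htame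
  have hmin' := hmin n f f.injective hf n y hyinj hydisj
  have hsum0 : ∑ i, dist (f i) (y i) ^ 2 ≤ 0 := by nlinarith
  have hzero : ∀ i, dist (f i) (y i) ^ 2 = 0 := fun i =>
    (Finset.sum_eq_zero_iff_of_nonneg fun j _ => by positivity).1
      (le_antisymm hsum0 (Finset.sum_nonneg fun j _ => by positivity)) i (Finset.mem_univ i)
  have hyf : y = ⇑f := funext fun i => (dist_eq_zero.1 (pow_eq_zero_iff two_ne_zero |>.1 (hzero i))).symm
  have hglued : (S \ coreOf S K ρ) ∪ Set.range y = S := by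
    rw [hyf, hf, sdiff_union_of_subset (coreOf_subset S K ρ)]
  intro k hk
  have hkcore : k ∈ coreOf S K ρ := ⟨hKS hk, k, hk, by rw [dist_self]; exact hρ⟩
  rw [← hf] at hkcore
  obtain ⟨i, hi⟩ := hkcore
  have ht := htame i
  rw [hglued, hyf] at ht
  rw [← hi]
  exact ht

/-- **(QE) ∧ (QC) ⇒ [MCMC] (PROVED)** — through part YH's `mildCoolMoatCorePG_of_mildClamped`. [this file, g65] -/
theorem mildCoolMoatCorePG_of_slavedFilling_convexity {ϑc ϑ ϑp r q rsh ρ rm dm κ aHi Λ θ s : ℝ} (hκ : 0 < κ) (hρ : 0 ≤ ρ)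
    (hE : CoolMoatSlavedFillingP ϑc ϑ ϑp r q rsh ρ rm dm aHi Λ θ s) (hC : MildClampedConvexityP ϑ ϑp q ρ rm dm κ aHi Λ θ s) :
    MildCoolMoatCorePG ϑc ϑ ϑp r q rsh rm aHi Λ θ s :=
  mildCoolMoatCorePG_of_mildClamped (mildCoolMoatClampedCoreP_of_slavedFilling_convexity hκ hρ hE hC)

/-- ★★ **THE VARIATIONAL MILD DOCKET `VariationalMildDocket ϑm ra κ`** — `MildColdSereneDocket ϑm ra` with its door [MCMC](ϑm) replaced by the two analytic halves
(QE)(ϑm, dm = 1/2, ρ = rm = 16) and (QC)(κ, dm = 1/2); antitone in `ϑm`, monotone-weaker in `ra`, antitone in `κ` (PROVED). [this file, g65] -/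
def VariationalMildDocket (ϑm ra κ : ℝ) : Prop :=
  CoolMoatSlavedFillingP ϑm tameRadius (1 / 10) 8 4 12 16 16 (1 / 2) 1 2 (1 / 16) (1 / 50) ∧
    MildClampedConvexityP tameRadius (1 / 10) 4 16 16 (1 / 2) κ 1 2 (1 / 16) (1 / 50) ∧
      MildSlenderSereneHotSparseBPG ϑm tameRadius 8 ra dressLevel dressLevel dressExponent 8 collarRadius clusterSize 4 32 8 (1 / 10) 24 1 2 (1 / 16) (1 / 50) ∧
        MildBuriedSereneHotSparseBPG ϑm tameRadius 8 ra dressLevel dressLevel dressExponent 8 collarRadius clusterSize 8 (1 / 10) 24 1 2 (1 / 16) (1 / 50)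

/-- **VARIATIONAL ⇒ MILD COLD DOCKET (PROVED)** for `0 < κ`. [this file, g65] -/
theorem mildColdSereneDocket_of_variational {ϑm ra κ : ℝ} (hκ : 0 < κ) (hV : VariationalMildDocket ϑm ra κ) : MildColdSereneDocket ϑm ra :=
  ⟨mildCoolMoatCorePG_of_slavedFilling_convexity hκ (by norm_num) hV.1 hV.2.1, hV.2.2.1, hV.2.2.2⟩

/-- **THE DIALS OF THE VARIATIONAL DOCKET (PROVED)**: colder moat, wider serenity radius, smaller modulus are all weaker. [this file, g65] -/
theorem VariationalMildDocket.of_le {ϑm ϑm' ra ra' κ κ' : ℝ} (h : ϑm' ≤ ϑm) (hra : ra ≤ ra') (hκ : κ' ≤ κ) (hV : VariationalMildDocket ϑm ra κ) :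
    VariationalMildDocket ϑm' ra' κ' :=
  ⟨hV.1.of_moat_le h, hV.2.1.of_le hκ, hV.2.2.1.of_moat_le h hra, hV.2.2.2.of_moat_le h hra⟩

/-- ★★★ **COLUMN `_16XH28BV` — THE VARIATIONAL SIDE COLUMN** (row 1189 (c″) (M1)): `_16XH28B` with the mild cold docket replaced by the VARIATIONAL one — the door
[MCMC] DISCHARGED into (QE) existence of the slaved tame critical filling (perturbative in the moat temperature, a dial) and (QC) strong convexity on the mild class
(Born floor at amplitude `1/10`), both SIDEWAYS analytic leaves (hence a side column by the trade rule), at ANY `ϑm`, `ra ≥ 24`, `κ > 0` of the prover's choosing. -/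
theorem gap_and_pert_1_50_of_certs_16XH28BV (hL : LatticeLiouvilleCert) (hL' : LayeredLiouvilleCert)
    (hR : OscRigidityL2BDPG 1 2 (1 / 16) (1 / 16)) (hX : ExcessFlatnessControlP 1 2 (1 / 16) (1 / 16))
    (hE : ExcessChartLocalisationP 1 2 (1 / 16) (1 / 100)) (hP : RegistrationP 1 2 (1 / 16) (1 / 100))
    (hT : TailDominationCert) (hU : UniformTameStabilityE (1 / 50) 2 (1 / 2000))
    (h1 : WordTransplantP 1 2 (1 / 16) (1 / 100)) (hGT : GradReframingThickP 1 2 (1 / 16) (1 / 100) (1 / 50))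
    (hΛ0 : LaunderingAprioriPX 1 2 (1 / 16) (1 / 100) (1 / 50)) (hΛs : LaunderingStepPX 1 2 (1 / 16) (1 / 100) (1 / 50))
    (hUc : UntwistCollarP 1 2 (1 / 16) (1 / 50))
    (hl : BondIsoLevelsP 1 2 (1 / 16) (1 / 50)) (hN : EnergyNearChartPX 1 2 (1 / 16) (1 / 50) (1 / 2000))
    (hF : TailForceSlavingP 1 2 (1 / 16) (1 / 50))
    (hE' : LipDualLinearisationP 1 2 (1 / 16) (1 / 50)) (hA : L2HarmonicApproxPE 1 2 (1 / 16) (1 / 50) (1 / 2000))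
    (hD : PositionDecayPLE 1 2 (1 / 16) (1 / 50) (1 / 2000)) (hC : PositionCaccioppoliPGE 1 2 (1 / 16) (1 / 50) (1 / 2000))
    (hI : DressedCorePG tameRadius dressLevel dressLevel dressExponent 8 collarRadius clusterSize 1 2 (1 / 16) (1 / 50))
    (hVMD : ∃ ϑm ra κ ϑ₁ ω₁ : ℝ, 0 < κ ∧ ϑ₁ ≤ ϑm ∧ 24 ≤ ra ∧ 4 * ω₁ + ϑ₁ < tameRadius ∧ VariationalMildDocket ϑm ra κ ∧
      TameBallIncoherenceSparseBPG ϑ₁ ω₁ tameRadius 8 1 2 (1 / 16) (1 / 50))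
    (hWHS : HotSparseBPG (1 / 10) 1 2 (1 / 16) (1 / 50))
    (hG : PeriodicBulkGapDoor 2) : VisibleGap (1 / 50) ∧ PertRegime (1 / 50) := by
  obtain ⟨ϑm, ra, κ, ϑ₁, ω₁, hκ, hϑ₁, hra, hside, hV, hTB⟩ := hVMD
  exact gap_and_pert_1_50_of_certs_16XH28B hL hL' hR hX hE hP hT hU h1 hGT hΛ0 hΛs hUc hl hN hF hE' hA hD hC hI ⟨ϑm, ra, ϑ₁, ω₁, hϑ₁, hra, hside, mildColdSereneDocket_of_variational hκ hV, hTB⟩ hWHS hG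

/-- ★★★ **COLUMN `_16XH28BVT` — THE VARIATIONAL COLD COLUMN**: (MKᵇᵃˡˡ) ∧ `∃ ϑm ra κ, 0 < ϑm ∧ 24 ≤ ra ∧ 0 < κ ∧ VariationalMildDocket ϑm ra κ` ∧ [WHSᵇ](1/10) with the
generic leaves ⇒ the gap; the moat may be taken as cold as the existence half (QE) wants. [this file, g65] -/
theorem gap_and_pert_1_50_of_certs_16XH28BVT (hL : LatticeLiouvilleCert) (hL' : LayeredLiouvilleCert)
    (hR : OscRigidityL2BDPG 1 2 (1 / 16) (1 / 16)) (hX : ExcessFlatnessControlP 1 2 (1 / 16) (1 / 16))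
    (hE : ExcessChartLocalisationP 1 2 (1 / 16) (1 / 100)) (hP : RegistrationP 1 2 (1 / 16) (1 / 100))
    (hT : TailDominationCert) (hU : UniformTameStabilityE (1 / 50) 2 (1 / 2000))
    (h1 : WordTransplantP 1 2 (1 / 16) (1 / 100)) (hGT : GradReframingThickP 1 2 (1 / 16) (1 / 100) (1 / 50))
    (hΛ0 : LaunderingAprioriPX 1 2 (1 / 16) (1 / 100) (1 / 50)) (hΛs : LaunderingStepPX 1 2 (1 / 16) (1 / 100) (1 / 50))
    (hUc : UntwistCollarP 1 2 (1 / 16) (1 / 50))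
    (hl : BondIsoLevelsP 1 2 (1 / 16) (1 / 50)) (hN : EnergyNearChartPX 1 2 (1 / 16) (1 / 50) (1 / 2000))
    (hF : TailForceSlavingP 1 2 (1 / 16) (1 / 50))
    (hE' : LipDualLinearisationP 1 2 (1 / 16) (1 / 50)) (hA : L2HarmonicApproxPE 1 2 (1 / 16) (1 / 50) (1 / 2000))
    (hD : PositionDecayPLE 1 2 (1 / 16) (1 / 50) (1 / 2000)) (hC : PositionCaccioppoliPGE 1 2 (1 / 16) (1 / 50) (1 / 2000))
    (hI : DressedCorePG tameRadius dressLevel dressLevel dressExponent 8 collarRadius clusterSize 1 2 (1 / 16) (1 / 50))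
    (hMK : TameBallTiltStrainBPG tameRadius 8 1 2 (1 / 16) (1 / 50))
    (hVCold : ∃ ϑm ra κ : ℝ, 0 < ϑm ∧ 24 ≤ ra ∧ 0 < κ ∧ VariationalMildDocket ϑm ra κ)
    (hWHS : HotSparseBPG (1 / 10) 1 2 (1 / 16) (1 / 50))
    (hG : PeriodicBulkGapDoor 2) : VisibleGap (1 / 50) ∧ PertRegime (1 / 50) := by
  obtain ⟨ϑm, ra, κ, hm, hra, hκ, hV⟩ := hVCold
  exact gap_and_pert_1_50_of_certs_16XH28BT hL hL' hR hX hE hP hT hU h1 hGT hΛ0 hΛs hUc hl hN hF hE' hA hD hC hI hMK ⟨ϑm, ra, hm, hra, mildColdSereneDocket_of_variational hκ hV⟩ hWHS hG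

end Summit.AtomisticToContinuum.Crystallization.Theorems.ChartedZeroExcessLayeredLatticeLiouville

end
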